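import Literature.Analysis.SpecialFunctions.RiemannThetaLineDerivatives
import Literature.NumberTheory.ModularForms.BinaryThetaHigherWeight
import Mathlib.Analysis.Complex.UpperHalfPlane.Manifold
import Mathlib.Analysis.Complex.UpperHalfPlane.FunctionsBoundedAtInfty
import Mathlib.Analysis.Complex.LocallyUniformLimit
import HarnessLib

/-!
# Binary theta series of weight `n + 1` on lines `τ ↦ τ·P`: holomorphy on `ℍ` and vanishing at `i∞`
# (Hecke 1926 §3; Schoeneberg 1939 — "is a cusp form if `d` is strictly positive")

Topic `Literature/NumberTheory/ModularForms`; namespace `Literature.NumberTheory.ModularForms.BinaryTheta`.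
Everything here is PROVED (theorems only; no definition, no named fact).  Sequel of
`BinaryThetaHigherWeight` (the weight-`(n+1)` transformation law of the `n`-th derivative of a binary
theta function along an isotropic line) and of `RiemannThetaLineDerivatives` (that derivative is the
theta series with the polynomial `(2πi ᵗ(m+a)u)ⁿ` inserted): the two ANALYTIC cusp-form conditions for
the functions

  `Θₙ[a; b; P; u](τ) = (d/ds)ⁿ ϑ[a; b](s u, τ·P)|_{s=0} = Σ_{m ∈ ℤ²} (2πi ᵗ(m+a)u)ⁿ e(πi τ ᵗ(m+a)P(m+a) + 2πi ᵗ(m+a)b)`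

(`a, b ∈ ℚ²`, `P ∈ Sym₂(ℚ)` positive definite, `u ∈ ℂ²`, `n ≥ 1`) — the weight-`(n+1)` analogues of the
weight-two (`n = 1`, gradient) statements of the Summit-side files `…HeckeThetaPartnerAdicAtTwoThetaLines*`
of route `ResidualThetaTransportAtTwo`:

* `iteratedDeriv_line_hasSum` — `Θₙ(τ)` IS the displayed series (as a `HasSum`) (from `iteratedDeriv_riemannThetaChar_line_zero`);
* `norm_riemannThetaCharTerm_ratLine` — `|general term| = e^{-π Im τ · Q(m+a)}`, `Q(x) = ᵗxPx`;
* `le_sum_sq_add_ratCast_of_ne_zero` — rational characteristics stay away from the lattice;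
* **`isZeroAtImInfty_iteratedDeriv_line`** — for `n ≥ 1`, `Θₙ(τ) → 0` as `Im τ → ∞` (every term is
  `O(e^{-π q₀ Im τ})`, `q₀ > 0`, except `m = -a`, whose weight `(2πi·0)ⁿ` vanishes: Zagier, 1-2-3 §3.2,
  "and is a cusp form if `d` is strictly positive");
* **`mdifferentiable_iteratedDeriv_line`** — `Θₙ` is holomorphic on `ℍ` (locally uniformly convergent
  series of exponentials, Mathlib `differentiableOn_tsum_of_summable_norm`).

Not here: the behaviour at the other cusps / the `SL₂(ℤ)`-stability of the span of the `Θₙ` and the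
packaging as `CuspForm (Gamma0 N) (n+1)` (the weight-`(n+1)` analogues of `…ThetaLinesSlash`,
`…ThetaLinesSpan`, `…CuspFormOfSpan`), the `q`-expansion over ideals and Hecke's class theta series.
This is the third brick of the weight-`k` input `X_k` of `Ribet1977_cmNewform_gamma0_of_isGrossencharakter`.

## References

* E. Hecke, *Zur Theorie der elliptischen Modulfunktionen*, Math. Ann. 97 (1926), §3. [Hecke1926Modulfunktionen]
* D. Zagier, *Elliptic modular forms and their applications* (The 1-2-3 of Modular Forms, 2008), §3.2
  (held text p. 51). [Zagier2008]
* H. Lange, C. Birkenhake, *Complex Abelian Varieties* (1992), §3.3.2 Prop. 3.3.6. [LangeBirkenhake1992]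
-/

noncomputable section

open Matrix Complex Filter Topology Set

open scoped Real MatrixGroups UpperHalfPlane Manifold

namespace Literature.NumberTheory.ModularForms.BinaryTheta

open Literature.Analysis.SpecialFunctions
open Literature.NumberTheory.Automorphic (siegelUpperHalfSpace mem_siegelUpperHalfSpace_iff)

/-! ### The line `τ·P` of a rational positive definite symmetric `P` -/

/-- **`τ·P ∈ 𝔥₂`** for `Im τ > 0` and `P ∈ Sym₂(ℚ)` positive definite (Literature twin of the
Summit-side `HeckeTheta.smul_ratCast_mem_siegelUpperHalfSpace`, not importable here).
[cite: LangeBirkenhake1992, §3.3.2 Prop. 3.3.6] -/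
theorem ratSmul_mem_siegelUpperHalfSpace {P : Matrix (Fin 2) (Fin 2) ℚ} (hPs : P.IsSymm)
    (hPpos : (P.map (Rat.cast : ℚ → ℝ)).PosDef) {τ : ℂ} (hτ : 0 < τ.im) :
    (τ • P.map (Rat.cast : ℚ → ℂ)) ∈ siegelUpperHalfSpace 2 := by
  rw [mem_siegelUpperHalfSpace_iff]
  refine ⟨(hPs.map _).smul τ, ?_⟩
  have hmap : (τ • P.map (Rat.cast : ℚ → ℂ)).map Complex.im = τ.im • P.map (Rat.cast : ℚ → ℝ) := by
    ext i j
    simp [Complex.mul_im]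
  rw [hmap]
  exact hPpos.smul hτ

/-- The hypotheses of the theta-series lemmas at the point `τ·P` (symmetry and `Im ≥ c > 0`;
Literature twin of the Summit-side `HeckeTheta.line_hyps`). [cite: LangeBirkenhake1992, §3.3.2 Prop. 3.3.6] -/
theorem ratLine_hyps {P : Matrix (Fin 2) (Fin 2) ℚ} (hPs : P.IsSymm)
    (hPpos : (P.map (Rat.cast : ℚ → ℝ)).PosDef) {τ : ℂ} (hτ : 0 < τ.im) :
    (∀ i j, (τ • P.map (Rat.cast : ℚ → ℂ)) i j = (τ • P.map (Rat.cast : ℚ → ℂ)) j i) ∧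
      ∃ c : ℝ, 0 < c ∧ ∀ x : Fin 2 → ℝ, c * ∑ i, x i ^ 2 ≤
        ∑ i, ∑ j, x i * ((τ • P.map (Rat.cast : ℚ → ℂ)) i j).im * x j := by
  have hZ := ratSmul_mem_siegelUpperHalfSpace hPs hPpos hτ
  exact ⟨fun i j => (hZ.1.apply i j).symm, exists_pos_mul_sum_sq_le_of_posDef_im _ hZ.2⟩

/-- **`Θₙ(τ)` is the series with the polynomial inserted**: for `Im τ > 0`,
`(d/ds)ⁿ ϑ[a;b](s u, τ·P)|₀ = Σ_m (2πi ᵗ(m+a)u)ⁿ e(πi τ ᵗ(m+a)P(m+a) + 2πi ᵗ(m+a) b)`, with absolute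
convergence (`iteratedDeriv_riemannThetaChar_line_zero`). [cite: LangeBirkenhake1992, §3.3.2 Prop. 3.3.7] -/
theorem iteratedDeriv_line_hasSum {P : Matrix (Fin 2) (Fin 2) ℚ} (hPs : P.IsSymm)
    (hPpos : (P.map (Rat.cast : ℚ → ℝ)).PosDef) (a b u : Fin 2 → ℂ) (n : ℕ) {τ : ℂ} (hτ : 0 < τ.im) :
    HasSum (fun m : Fin 2 → ℤ => (2 * π * I * ∑ i, ((m i : ℂ) + a i) * u i) ^ n *
        riemannThetaCharTerm a b (τ • P.map (Rat.cast : ℚ → ℂ)) 0 m)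
      (iteratedDeriv n (fun s : ℂ => riemannThetaChar a b (τ • P.map (Rat.cast : ℚ → ℂ)) (s • u)) 0) := by
  obtain ⟨hsym, c, hc, hY⟩ := ratLine_hyps hPs hPpos hτ
  rw [iteratedDeriv_riemannThetaChar_line_zero _ hsym hc hY a b u n]
  exact (summable_norm_lineWeightPow_mul_riemannThetaCharTerm _ hsym hc hY a b u 0 n).of_norm.hasSum

/-! ### Size of the general term and the distance of a rational characteristic to the lattice -/

/-- **The size of the general term on the line**: for rational characteristics,
`|e(πi ᵗ(m+a)(zP)(m+a) + 2πi ᵗ(m+a) b)| = e^{-π Im z · ᵗ(m+a)P(m+a)}` (Literature twin of the Summit-side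
`HeckeTheta.norm_riemannThetaCharTerm_line`). [cite: LangeBirkenhake1992, §3.3.2 Prop. 3.3.6] -/
theorem norm_riemannThetaCharTerm_ratLine (P : Matrix (Fin 2) (Fin 2) ℚ) (a b : Fin 2 → ℚ) (z : ℂ)
    (m : Fin 2 → ℤ) :
    ‖riemannThetaCharTerm (fun i => (a i : ℂ)) (fun i => (b i : ℂ)) (z • P.map (Rat.cast : ℚ → ℂ)) 0 m‖ =
      Real.exp (-(π * z.im * ∑ i, ∑ j, ((m i : ℝ) + a i) * (P i j : ℝ) * ((m j : ℝ) + a j))) := by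
  rw [riemannThetaCharTerm, Complex.norm_exp]
  congr 1
  set q : ℝ := ∑ i, ∑ j, ((m i : ℝ) + a i) * (P i j : ℝ) * ((m j : ℝ) + a j) with hq
  set r : ℝ := ∑ i, ((m i : ℝ) + a i) * (b i : ℝ) with hr
  have h1 : (((fun i => (m i : ℂ)) + fun i => (a i : ℂ)) ⬝ᵥ
      ((z • P.map (Rat.cast : ℚ → ℂ)) *ᵥ ((fun i => (m i : ℂ)) + fun i => (a i : ℂ)))) = z * (q : ℂ) := by
    simp only [dotProduct, mulVec, Fin.sum_univ_two, Matrix.smul_apply, Matrix.map_apply, Pi.add_apply,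
      smul_eq_mul, hq]
    push_cast
    ring
  have h2 : (((fun i => (m i : ℂ)) + fun i => (a i : ℂ)) ⬝ᵥ ((0 : Fin 2 → ℂ) + fun i => (b i : ℂ))) =
      (r : ℂ) := by
    simp only [dotProduct, Fin.sum_univ_two, Pi.add_apply, Pi.zero_apply, zero_add, hr]
    push_cast
    ring
  rw [h1, h2, show π * I * (z * (q : ℂ)) + 2 * π * I * (r : ℂ) =
      ((π * q : ℝ) : ℂ) * (I * z) + ((2 * π * r : ℝ) : ℂ) * I by push_cast; ring,
    Complex.add_re, Complex.re_ofReal_mul, Complex.re_ofReal_mul, Complex.I_mul_re, Complex.I_re]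
  ring

/-- The quadratic form of a positive definite `P ∈ Sym₂(ℚ)` bounds squares: `c Σ xᵢ² ≤ ᵗxPx` for some
`c > 0`. [folklore] -/
private theorem exists_pos_quadForm_ge_rat {P : Matrix (Fin 2) (Fin 2) ℚ} (hPs : P.IsSymm)
    (hPpos : (P.map (Rat.cast : ℚ → ℝ)).PosDef) :
    ∃ c : ℝ, 0 < c ∧ ∀ x : Fin 2 → ℝ, c * ∑ i, x i ^ 2 ≤ ∑ i, ∑ j, x i * (P i j : ℝ) * x j := by
  obtain ⟨-, c, hc, hY⟩ := ratLine_hyps hPs hPpos (τ := I) (by simp)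
  refine ⟨c, hc, fun x => ?_⟩
  have h := hY x
  simpa [Matrix.smul_apply, Matrix.map_apply] using h

/-- **Rational characteristics stay away from the lattice**: if `m + a ≠ 0` then
`Σ (mᵢ + aᵢ)² ≥ 1/N²` with `N = den(a₀) den(a₁)`. [folklore] -/
private theorem le_sum_sq_add_ratCast_of_ne_zero (a : Fin 2 → ℚ) (m : Fin 2 → ℤ)
    (h : ∃ i, (m i : ℚ) + a i ≠ 0) :
    1 / (((a 0).den * (a 1).den : ℕ) : ℝ) ^ 2 ≤ ∑ i, ((m i : ℝ) + a i) ^ 2 := by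
  obtain ⟨i, hi⟩ := h
  set N : ℕ := (a 0).den * (a 1).den with hN
  have hNpos : (0 : ℝ) < N := by
    have : 0 < N := mul_pos (a 0).den_pos (a 1).den_pos
    exact_mod_cast this
  -- `(m i + a i) N` is a nonzero integer
  have hint : ∃ z : ℤ, ((m i : ℚ) + a i) * N = z := by
    have h0 : (a 0) * N = (a 0).num * (a 1).den := by
      rw [hN]; push_cast; rw [← mul_assoc, Rat.mul_den_eq_num]
    have h1 : (a 1) * N = (a 1).num * (a 0).den := by
      rw [hN]; push_cast; rw [mul_comm ((a 0).den : ℚ), ← mul_assoc, Rat.mul_den_eq_num]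
    fin_cases i
    · exact ⟨m 0 * N + (a 0).num * (a 1).den, by push_cast; rw [add_mul, h0]⟩
    · exact ⟨m 1 * N + (a 1).num * (a 0).den, by push_cast; rw [add_mul, h1]⟩
  obtain ⟨z, hz⟩ := hint
  have hz0 : z ≠ 0 := by
    rintro rfl
    have : ((m i : ℚ) + a i) * N = 0 := by exact_mod_cast hz
    rcases mul_eq_zero.mp this with h | h
    · exact hi h
    · exact hNpos.ne' (by exact_mod_cast h)
  have hz1 : (1 : ℝ) ≤ (z : ℝ) ^ 2 := by
    have : (1 : ℤ) ≤ z ^ 2 := by nlinarith [Int.one_le_abs hz0, sq_abs z]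
    exact_mod_cast this
  have hzi : ((m i : ℝ) + a i) = (z : ℝ) / N := by
    have : ((m i : ℝ) + a i) * N = z := by exact_mod_cast hz
    field_simp
    linarith [this]
  calc 1 / ((N : ℕ) : ℝ) ^ 2 ≤ (z : ℝ) ^ 2 / (N : ℝ) ^ 2 := by
        rw [div_le_div_iff_of_pos_right (by positivity)]; exact hz1
    _ = ((m i : ℝ) + a i) ^ 2 := by rw [hzi, div_pow]
    _ ≤ ∑ j, ((m j : ℝ) + a j) ^ 2 :=
        Finset.single_le_sum (f := fun j => ((m j : ℝ) + a j) ^ 2) (fun j _ => sq_nonneg _)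
          (Finset.mem_univ i)

/-! ### Vanishing at `i∞` -/

/-- **`Θₙ(τ) → 0` as `Im τ → ∞` for `n ≥ 1`** (rational characteristics): every term of
`Σ_m (2πi ᵗ(m+a)u)ⁿ e(πi τ Q(m+a) + 2πi ᵗ(m+a)b)` is `O(e^{-π q₀ Im τ})` with `q₀ > 0`, except the term
`m = -a`, whose weight `(2πi · 0)ⁿ` vanishes because `n ≥ 1` — Zagier, 1-2-3 §3.2: "`Θ_{Q,P}` … is a cusp
form if `d` is strictly positive" (here: the condition at the cusp `i∞`). [cite: Zagier2008, §3.2]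
[cite: Hecke1926Modulfunktionen, §3] -/
theorem isZeroAtImInfty_iteratedDeriv_line {P : Matrix (Fin 2) (Fin 2) ℚ} (hPs : P.IsSymm)
    (hPpos : (P.map (Rat.cast : ℚ → ℝ)).PosDef) (a b : Fin 2 → ℚ) (u : Fin 2 → ℂ) {n : ℕ} (hn : 1 ≤ n) :
    UpperHalfPlane.IsZeroAtImInfty (fun τ : ℍ => iteratedDeriv n (fun s : ℂ =>
      riemannThetaChar (fun i => (a i : ℂ)) (fun i => (b i : ℂ)) ((τ : ℂ) • P.map (Rat.cast : ℚ → ℂ))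
        (s • u)) 0) := by
  rw [UpperHalfPlane.isZeroAtImInfty_iff]
  intro ε hε
  set Q : (Fin 2 → ℤ) → ℝ := fun m => ∑ i, ∑ j, ((m i : ℝ) + a i) * (P i j : ℝ) * ((m j : ℝ) + a j) with hQ
  set W : (Fin 2 → ℤ) → ℂ := fun m => (2 * π * I * ∑ i, ((m i : ℂ) + (a i : ℂ)) * u i) ^ n with hW
  set A : (Fin 2 → ℤ) → ℝ := fun m => ‖W m‖ * Real.exp (-(π * Q m)) with hAdef
  obtain ⟨c, hc, hcQ⟩ := exists_pos_quadForm_ge_rat hPs hPpos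
  set N : ℕ := (a 0).den * (a 1).den with hN
  have hNpos : (0 : ℝ) < N := by
    have : 0 < N := mul_pos (a 0).den_pos (a 1).den_pos
    exact_mod_cast this
  set q₀ : ℝ := c / (N : ℝ) ^ 2 with hq₀
  have hq₀pos : 0 < q₀ := by positivity
  have hQnn : ∀ m, 0 ≤ Q m := fun m =>
    le_trans (mul_nonneg hc.le (Finset.sum_nonneg fun i _ => sq_nonneg _)) (hcQ _)
  have hQlow : ∀ m : Fin 2 → ℤ, (∃ i, (m i : ℚ) + a i ≠ 0) → q₀ ≤ Q m := by
    intro m hm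
    have h1 := le_sum_sq_add_ratCast_of_ne_zero a m hm
    have h2 := hcQ (fun i => (m i : ℝ) + a i)
    calc q₀ = c * (1 / (N : ℝ) ^ 2) := by rw [hq₀]; ring
      _ ≤ c * ∑ i, ((m i : ℝ) + a i) ^ 2 := mul_le_mul_of_nonneg_left h1 hc.le
      _ ≤ Q m := h2
  -- summability of `A` (the term norms at `τ = i`)
  have hAs : Summable A := by
    have hS := (iteratedDeriv_line_hasSum hPs hPpos (fun i => (a i : ℂ)) (fun i => (b i : ℂ)) u n
      (τ := I) (by simp)).summable.norm
    refine hS.congr fun m => ?_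
    simp only [hAdef, hW, hQ]
    rw [norm_mul, norm_riemannThetaCharTerm_ratLine, Complex.I_im, mul_one]
  set C : ℝ := ∑' m, A m with hC
  have hC0 : 0 ≤ C := tsum_nonneg fun m => by positivity
  -- choose the height
  obtain ⟨Y, hY⟩ : ∃ Y : ℝ, ∀ y ≥ Y, C * Real.exp (-(π * (y - 1) * q₀)) < ε ∧ 1 ≤ y := by
    have ht : Tendsto (fun y : ℝ => C * Real.exp (-(π * (y - 1) * q₀))) atTop (𝓝 0) := by
      have h1 : Tendsto (fun y : ℝ => -(π * (y - 1) * q₀)) atTop atBot := by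
        have : (fun y : ℝ => -(π * (y - 1) * q₀)) = fun y => (-(π * q₀)) * y + π * q₀ := by
          funext y; ring
        rw [this]
        exact tendsto_atBot_add_const_right _ _
          (tendsto_id.const_mul_atTop_of_neg (by nlinarith [Real.pi_pos]))
      simpa using (Real.tendsto_exp_atBot.comp h1).const_mul C
    obtain ⟨Y, hY⟩ := ((ht.eventually (gt_mem_nhds hε)).and (eventually_ge_atTop (1 : ℝ))).exists_forall_of_atTop
    exact ⟨Y, fun y hy => hY y hy⟩
  refine ⟨Y, fun τ hτ => ?_⟩
  obtain ⟨hlt, hy1⟩ := hY τ.im hτ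
  have hS := iteratedDeriv_line_hasSum hPs hPpos (fun i => (a i : ℂ)) (fun i => (b i : ℂ)) u n τ.im_pos
  -- termwise bound
  have hle : ∀ m : Fin 2 → ℤ,
      ‖W m * riemannThetaCharTerm (fun i => (a i : ℂ)) (fun i => (b i : ℂ))
            (((τ : ℂ)) • P.map (Rat.cast : ℚ → ℂ)) 0 m‖ ≤
        A m * Real.exp (-(π * (τ.im - 1) * q₀)) := by
    intro m
    by_cases hm : ∃ i, (m i : ℚ) + a i ≠ 0
    · rw [norm_mul, norm_riemannThetaCharTerm_ratLine]
      have hexp : Real.exp (-(π * (τ : ℂ).im * Q m)) ≤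
          Real.exp (-(π * Q m)) * Real.exp (-(π * (τ.im - 1) * q₀)) := by
        rw [← Real.exp_add, Real.exp_le_exp, UpperHalfPlane.coe_im]
        have h1 := hQlow m hm
        have h2 : 0 ≤ τ.im - 1 := by linarith
        nlinarith [Real.pi_pos, mul_nonneg h2 (sub_nonneg.mpr h1)]
      calc _ = ‖W m‖ * Real.exp (-(π * (τ : ℂ).im * Q m)) := rfl
        _ ≤ ‖W m‖ * (Real.exp (-(π * Q m)) * Real.exp (-(π * (τ.im - 1) * q₀))) :=
            mul_le_mul_of_nonneg_left hexp (norm_nonneg _)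
        _ = A m * Real.exp (-(π * (τ.im - 1) * q₀)) := by simp only [hAdef]; ring
    · -- the weight vanishes: `m + a = 0` and `n ≥ 1`
      push Not at hm
      have h0 : ∑ i, ((m i : ℂ) + (a i : ℂ)) * u i = 0 := by
        refine Finset.sum_eq_zero fun i _ => ?_
        have := hm i
        have h' : (m i : ℂ) + (a i : ℂ) = 0 := by exact_mod_cast this
        rw [h', zero_mul]
      have hW0 : W m = 0 := by
        simp only [hW, h0, mul_zero]
        exact zero_pow (by omega)
      rw [hW0, zero_mul, norm_zero]
      positivity
  have hsumm : Summable fun m : Fin 2 → ℤ => A m * Real.exp (-(π * (τ.im - 1) * q₀)) := hAs.mul_right _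
  calc ‖iteratedDeriv n (fun s : ℂ => riemannThetaChar (fun i => (a i : ℂ)) (fun i => (b i : ℂ))
          (((τ : ℂ)) • P.map (Rat.cast : ℚ → ℂ)) (s • u)) 0‖
      = ‖∑' m : Fin 2 → ℤ, W m * riemannThetaCharTerm (fun i => (a i : ℂ)) (fun i => (b i : ℂ))
            (((τ : ℂ)) • P.map (Rat.cast : ℚ → ℂ)) 0 m‖ := by rw [hS.tsum_eq]
    _ ≤ ∑' m : Fin 2 → ℤ, ‖W m * riemannThetaCharTerm (fun i => (a i : ℂ)) (fun i => (b i : ℂ))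
            (((τ : ℂ)) • P.map (Rat.cast : ℚ → ℂ)) 0 m‖ :=
        norm_tsum_le_tsum_norm (Summable.of_nonneg_of_le (fun m => norm_nonneg _) hle hsumm)
    _ ≤ ∑' m : Fin 2 → ℤ, A m * Real.exp (-(π * (τ.im - 1) * q₀)) :=
        Summable.tsum_le_tsum hle (Summable.of_nonneg_of_le (fun m => norm_nonneg _) hle hsumm) hsumm
    _ = C * Real.exp (-(π * (τ.im - 1) * q₀)) := by rw [tsum_mul_right]
    _ ≤ ε := hlt.le

/-! ### Holomorphy on `ℍ` -/

/-- The general term on the line is an exponential `e(z K₁ + K₂)` in `z`. [folklore] -/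
private theorem riemannThetaCharTerm_ratLine_eq_cexp (P : Matrix (Fin 2) (Fin 2) ℚ) (a b : Fin 2 → ℚ)
    (m : Fin 2 → ℤ) : ∃ K₁ K₂ : ℂ, ∀ z : ℂ,
    riemannThetaCharTerm (fun i => (a i : ℂ)) (fun i => (b i : ℂ)) (z • P.map (Rat.cast : ℚ → ℂ)) 0 m =
      cexp (z * K₁ + K₂) := by
  refine ⟨π * I * ((((fun i => (m i : ℂ)) + fun i => (a i : ℂ)) ⬝ᵥ
      (P.map (Rat.cast : ℚ → ℂ) *ᵥ ((fun i => (m i : ℂ)) + fun i => (a i : ℂ))))),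
    2 * π * I * ((((fun i => (m i : ℂ)) + fun i => (a i : ℂ)) ⬝ᵥ ((0 : Fin 2 → ℂ) + fun i => (b i : ℂ)))),
    fun z => ?_⟩
  rw [riemannThetaCharTerm]
  congr 1
  simp only [dotProduct, mulVec, Fin.sum_univ_two, Matrix.smul_apply, Matrix.map_apply, Pi.add_apply,
    smul_eq_mul]
  ring

/-- **`Θₙ = (d/ds)ⁿ ϑ[a; b](s u, τ·P)|₀` is holomorphic on `ℍ`** (rational data, `P` positive definite):
a locally uniformly convergent series of exponentials in `τ` (Hecke 1926 §3; Lange–Birkenhake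
Prop. 3.3.6 for the convergence). [cite: Hecke1926Modulfunktionen, §3] [cite: LangeBirkenhake1992, §3.3.2 Prop. 3.3.6] -/
theorem mdifferentiable_iteratedDeriv_line {P : Matrix (Fin 2) (Fin 2) ℚ} (hPs : P.IsSymm)
    (hPpos : (P.map (Rat.cast : ℚ → ℝ)).PosDef) (a b : Fin 2 → ℚ) (u : Fin 2 → ℂ) (n : ℕ) :
    MDifferentiable 𝓘(ℂ) 𝓘(ℂ) (fun τ : ℍ => iteratedDeriv n (fun s : ℂ =>
      riemannThetaChar (fun i => (a i : ℂ)) (fun i => (b i : ℂ)) ((τ : ℂ) • P.map (Rat.cast : ℚ → ℂ))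
        (s • u)) 0) := by
  rw [UpperHalfPlane.mdifferentiable_iff]
  set W : (Fin 2 → ℤ) → ℂ := fun m => (2 * π * I * ∑ i, ((m i : ℂ) + (a i : ℂ)) * u i) ^ n with hW
  set F : (Fin 2 → ℤ) → ℂ → ℂ := fun m z =>
    W m * riemannThetaCharTerm (fun i => (a i : ℂ)) (fun i => (b i : ℂ)) (z • P.map (Rat.cast : ℚ → ℂ)) 0 m
    with hF
  set Q : (Fin 2 → ℤ) → ℝ := fun m => ∑ i, ∑ j, ((m i : ℝ) + a i) * (P i j : ℝ) * ((m j : ℝ) + a j) with hQ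
  obtain ⟨c, hc, hcQ⟩ := exists_pos_quadForm_ge_rat hPs hPpos
  have hQnn : ∀ m, 0 ≤ Q m := fun m =>
    le_trans (mul_nonneg hc.le (Finset.sum_nonneg fun i _ => sq_nonneg _)) (hcQ _)
  -- each term is entire
  have hdiffF : ∀ m, Differentiable ℂ (F m) := by
    intro m
    obtain ⟨K₁, K₂, hK⟩ := riemannThetaCharTerm_ratLine_eq_cexp P a b m
    have : F m = fun z => W m * cexp (z * K₁ + K₂) := by
      funext z; rw [hF]; simp only [hK z]
    rw [this]
    fun_prop
  -- the series on `{Im z > y}`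
  have hdiffy : ∀ y : ℝ, 0 < y → DifferentiableOn ℂ (fun z => ∑' m, F m z) {z : ℂ | y < z.im} := by
    intro y hy
    have hyI : 0 < (((y : ℝ) : ℂ) * I).im := by simp [hy]
    have hS := (iteratedDeriv_line_hasSum hPs hPpos (fun i => (a i : ℂ)) (fun i => (b i : ℂ)) u n
      hyI).summable.norm
    have hnorm : ∀ m (w : ℂ), ‖F m w‖ = ‖W m‖ * Real.exp (-(π * w.im * Q m)) := fun m w => by
      simp only [hF, hQ]
      rw [norm_mul, norm_riemannThetaCharTerm_ratLine]
    refine differentiableOn_tsum_of_summable_norm (u := fun m => ‖F m (((y : ℝ) : ℂ) * I)‖) hS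
      (fun m => (hdiffF m).differentiableOn) (isOpen_lt continuous_const Complex.continuous_im)
      fun m z hz => ?_
    rw [hnorm, hnorm]
    refine mul_le_mul_of_nonneg_left ?_ (norm_nonneg _)
    rw [Real.exp_le_exp]
    have hzim : y ≤ z.im := le_of_lt hz
    have him : (((y : ℝ) : ℂ) * I).im = y := by simp
    rw [him]
    nlinarith [Real.pi_pos, mul_nonneg (sub_nonneg.mpr hzim) (hQnn m)]
  have hdiff : DifferentiableOn ℂ (fun z => ∑' m, F m z) {z : ℂ | 0 < z.im} := by
    intro z hz
    have h := hdiffy (z.im / 2) (by simp only [Set.mem_setOf_eq] at hz; linarith)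
    have hzmem : z ∈ {w : ℂ | z.im / 2 < w.im} := by
      simp only [Set.mem_setOf_eq] at hz ⊢; linarith
    exact (h.differentiableAt ((isOpen_lt continuous_const Complex.continuous_im).mem_nhds hzmem)).differentiableWithinAt
  refine hdiff.congr fun z hz => ?_
  simp only [Set.mem_setOf_eq] at hz
  simp only [Function.comp_apply, UpperHalfPlane.ofComplex_apply_of_im_pos hz]
  exact ((iteratedDeriv_line_hasSum hPs hPpos (fun i => (a i : ℂ)) (fun i => (b i : ℂ)) u n
    (τ := z) hz).tsum_eq).symm

end Literature.NumberTheory.ModularForms.BinaryTheta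

end
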